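import Summits.NavierStokesRegularity.NavierStokesRegularity.Theorems.SqueezeCycleSingularZoomWindow
import Summits.NavierStokesRegularity.NavierStokesRegularity.Theorems.SqueezeCycleExtremalElementExistsEnergy
import HarnessLib

/-!
# Scale-invariant energies of Type-I Oseen-mild fields on growing windows pass to the limit
# (route `SqueezeCycle`, item `SingularZoom`, stmt-NavierStokesRegularity-10573)

Helper file for the singular Type-I zoom: the twin of `SqueezeCycleExtremalElementExistsEnergy`
for fields `w k` living on final windows `(A k, 0) × ℝ³`, `A k → -∞` (jointly continuous, weakly
divergence-free slices, Oseen integral equation, common Type-I bound `C/√(-t)`), whose local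
energies obey the two bounds of the route's class `𝒦` — `r⁻¹ ∫_{B(x₀,r)} |w k(t)|² ≤ B` and
`r⁻¹ ∫_{(t₀-r²,t₀)} ∫_{B(x₀,r)} |∇w k|² ≤ B` — only **eventually in `k`** for each fixed time,
resp. each fixed cylinder with vertex time `t₀ < 0`. If the `w k` converge with their gradients
pointwise on the open slab to a Type-I ancient mild field `W`, then `W` obeys both bounds on all
cylinders with vertex time `t₀ ≤ 0` (`energyBounds_of_tendsto_Ioo`): dominated convergence at
fixed negative times and on cylinders with `t₀ < 0` (the window-uniform gradient bound of
`SqueezeCycleSingularZoomWindow` dominates), and the exhaustion `(−r², −δ) ↑ (−r², 0)` of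
`scaledIntegral_vertex_zero` for `t₀ = 0`.
-/

noncomputable section

open MeasureTheory Set Function Filter TopologicalSpace Metric
open scoped Topology NNReal ENNReal

namespace Summit.NavierStokesRegularity.NavierStokesRegularity.Theorems

open Literature.Analysis Literature.Analysis.FluidPDE

section Limits

variable {F : Type*} [NormedAddCommGroup F]

/-- **Dominated convergence on a ball, squared norms, eventual hypotheses**: if `f j → g`
pointwise and, for all large `j`, `f j` is continuous with `‖f j‖ ≤ M`, then
`∫_{B} ‖f j‖² → ∫_{B} ‖g‖²` on every ball `B`. [folklore] -/
theorem tendsto_setIntegral_ball_norm_sq_of_eventually_bound {f : ℕ → EuclideanSpace ℝ (Fin 3) → F}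
    {g : EuclideanSpace ℝ (Fin 3) → F} {M : ℝ}
    (hf : ∀ᶠ j in atTop, Continuous (f j) ∧ ∀ x, ‖f j x‖ ≤ M)
    (hlim : ∀ x, Tendsto (fun j => f j x) atTop (𝓝 (g x)))
    (x₀ : EuclideanSpace ℝ (Fin 3)) (r : ℝ) :
    Tendsto (fun j => ∫ x in ball x₀ r, ‖f j x‖ ^ 2) atTop (𝓝 (∫ x in ball x₀ r, ‖g x‖ ^ 2)) := by
  refine tendsto_integral_filter_of_dominated_convergence (fun _ => M ^ 2) ?_ ?_ ?_ ?_
  · filter_upwards [hf] with j hj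
    exact ((hj.1).norm.pow 2).aestronglyMeasurable
  · filter_upwards [hf] with j hj
    refine Eventually.of_forall fun x => ?_
    rw [Real.norm_eq_abs, abs_of_nonneg (sq_nonneg _)]
    exact pow_le_pow_left₀ (norm_nonneg _) (hj.2 x) 2
  · exact integrableOn_const (measure_ball_lt_top.ne) |>.integrable
  · exact Eventually.of_forall fun x => ((hlim x).norm).pow 2

end Limits

section Class

/-- **The two scale-invariant energy bounds pass to the limit along Type-I Oseen-mild fields on
growing windows.** Let `w k` be jointly continuous on `(A k, 0) × ℝ³` (`A k → −∞`) with weakly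
divergence-free slices, the Oseen integral equation between all `A k < s < t < 0` and the common
Type-I bound `‖w k t x‖ ≤ C/√(−t)` there; suppose that for every `x₀`, every `t < 0` and every
`r > 0` eventually `r⁻¹ ∫_{B(x₀,r)} |w k(t)|² ≤ B`, and for every `x₀`, `t₀ < 0`, `r > 0` eventually
`r⁻¹ ∫_{(t₀-r²,t₀)} ∫_{B(x₀,r)} |∇ w k|² ≤ B` (`B ≥ 0`). If the `w k` converge with their gradients
pointwise on the open slab to a Type-I ancient mild field `W`, then `W` obeys both bounds on every
cylinder with vertex time `t₀ ≤ 0`. [folklore] -/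
theorem energyBounds_of_tendsto_Ioo (C : ℝ) {B : ℝ} (hB : 0 ≤ B) {A : ℕ → ℝ}
    (hA : Tendsto A atTop atBot)
    {w : ℕ → ℝ → EuclideanSpace ℝ (Fin 3) → EuclideanSpace ℝ (Fin 3)}
    (hc : ∀ k, ContinuousOn (uncurry (w k)) (Ioo (A k) 0 ×ˢ univ))
    (hdivw : ∀ k, ∀ t ∈ Ioo (A k) 0, IsWeaklyDivFree (w k t))
    (hmild : ∀ k, ∀ s t : ℝ, A k < s → s < t → t < 0 → ∀ x,
      w k t x = UnboundedOperators.heatExtension (w k s) (t - s) x - oseenDuhamel 1 s (w k) (w k) t x)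
    (hI : ∀ k, ∀ t ∈ Ioo (A k) 0, ∀ x, ‖w k t x‖ ≤ C / Real.sqrt (-t))
    (henA : ∀ (x₀ : EuclideanSpace ℝ (Fin 3)) (t : ℝ), t < 0 → ∀ r : ℝ, 0 < r →
      ∀ᶠ k in atTop, r⁻¹ * ∫ x in ball x₀ r, ‖w k t x‖ ^ 2 ≤ B)
    (henE : ∀ (x₀ : EuclideanSpace ℝ (Fin 3)) (t₀ r : ℝ), t₀ < 0 → 0 < r →
      ∀ᶠ k in atTop,
        r⁻¹ * ∫ t in Ioo (t₀ - r ^ 2) t₀, ∫ x in ball x₀ r, ‖fderiv ℝ (w k t) x‖ ^ 2 ≤ B)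
    {W : ℝ → EuclideanSpace ℝ (Fin 3) → EuclideanSpace ℝ (Fin 3)} (hW : IsTypeIAncientMild C W)
    (hpt : ∀ t < 0, ∀ x, Tendsto (fun k => w k t x) atTop (𝓝 (W t x)))
    (hptG : ∀ t < 0, ∀ x, Tendsto (fun k => fderiv ℝ (w k t) x) atTop (𝓝 (fderiv ℝ (W t) x))) :
    ∀ (x₀ : EuclideanSpace ℝ (Fin 3)) (t₀ r : ℝ), t₀ ≤ 0 → 0 < r →
      (∀ t, t₀ - r ^ 2 < t → t < t₀ → r⁻¹ * ∫ x in ball x₀ r, ‖W t x‖ ^ 2 ≤ B) ∧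
        r⁻¹ * ∫ t in Ioo (t₀ - r ^ 2) t₀, ∫ x in ball x₀ r, ‖fderiv ℝ (W t) x‖ ^ 2 ≤ B := by
  -- per-`k` facts
  have hsm : ∀ k, ContDiffOn ℝ (⊤ : ℕ∞) (uncurry (w k)) (Ioo (A k) 0 ×ˢ univ) := fun k =>
    contDiffOn_of_Ioo (hc k) (hdivw k) (hmild k) (hI k)
  have hDc : ∀ k, ContinuousOn (fun z : ℝ × EuclideanSpace ℝ (Fin 3) => fderiv ℝ (w k z.1) z.2)
      (Ioo (A k) 0 ×ˢ univ) := fun k =>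
    IsSmoothSpaceTimeOn.continuousOn_fderiv_slice (S := Ioo (A k) 0) (w := w k) (hsm k)
      isOpen_Ioo.uniqueDiffOn
  have hsmooth : ∀ k, ∀ t ∈ Ioo (A k) 0, ContDiff ℝ ((⊤ : ℕ∞) : WithTop ℕ∞) (w k t) :=
    fun k t ht => (hsm k).comp_contDiff (contDiff_prodMk_right t) fun x => ⟨ht, mem_univ x⟩
  have hslice : ∀ k, ∀ t ∈ Ioo (A k) 0, Continuous (w k t) := fun k t ht =>
    (hc k).comp_continuous (Continuous.prodMk_right t) fun x => ⟨ht, mem_univ x⟩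
  have hWDc : ContinuousOn (fun z : ℝ × EuclideanSpace ℝ (Fin 3) => fderiv ℝ (W z.1) z.2)
      (Iio 0 ×ˢ univ) :=
    IsSmoothSpaceTimeOn.continuousOn_fderiv_slice (S := Iio 0) (w := W) hW.contDiffOn
      isOpen_Iio.uniqueDiffOn
  have hlev : ∀ s : ℝ, ∀ᶠ k in atTop, A k < s := fun s => hA.eventually (eventually_lt_atBot s)
  -- the energy at a fixed negative time
  have hAW : ∀ (x₀ : EuclideanSpace ℝ (Fin 3)) (t₀ r : ℝ), t₀ ≤ 0 → 0 < r →
      ∀ t, t₀ - r ^ 2 < t → t < t₀ → r⁻¹ * ∫ x in ball x₀ r, ‖W t x‖ ^ 2 ≤ B := by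
    intro x₀ t₀ r ht₀ hr t ht1 ht2
    have ht : t < 0 := lt_of_lt_of_le ht2 ht₀
    have hf : ∀ᶠ k in atTop, Continuous (w k t) ∧ ∀ x, ‖w k t x‖ ≤ C / Real.sqrt (-t) := by
      filter_upwards [hlev t] with k hk
      exact ⟨hslice k t ⟨hk, ht⟩, fun x => hI k t ⟨hk, ht⟩ x⟩
    have hlim := (tendsto_setIntegral_ball_norm_sq_of_eventually_bound hf (hpt t ht) x₀ r).const_mul r⁻¹
    exact le_of_tendsto hlim (henA x₀ t ht r hr)
  -- the dissipation on cylinders with vertex time `t₀ < 0`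
  have hEneg : ∀ (x₀ : EuclideanSpace ℝ (Fin 3)) (t₀ r : ℝ), t₀ < 0 → 0 < r →
      r⁻¹ * ∫ t in Ioo (t₀ - r ^ 2) t₀, ∫ x in ball x₀ r, ‖fderiv ℝ (W t) x‖ ^ 2 ≤ B := by
    intro x₀ t₀ r ht₀ hr
    -- window-uniform gradient bound on the window `[t₀ - r², t₀/2)` for all large `k`
    obtain ⟨K, hK⟩ := exists_norm_iteratedFDeriv_le_of_typeI_Ioo C 1 (a := t₀ - r ^ 2 - 1)
      (b := t₀ / 2) (δ := 1) (by linarith [sq_nonneg r]) (by linarith) one_pos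
    have hKw : ∀ᶠ k in atTop, ∀ t ∈ Ioo (t₀ - r ^ 2) t₀, ∀ x, ‖fderiv ℝ (w k t) x‖ ≤ K := by
      filter_upwards [hlev (t₀ - r ^ 2 - 1)] with k hk
      intro t ht x
      have h := hK hk (hc k) (hdivw k) (hmild k) (hI k) t ⟨by linarith [ht.1], by linarith [ht.2]⟩ x
      rwa [norm_iteratedFDeriv_one] at h
    have hwin : ∀ᶠ k in atTop, A k < t₀ - r ^ 2 := hlev (t₀ - r ^ 2)
    -- inner integrals converge at every time of the window
    set Φ : ℕ → ℝ → ℝ := fun k t => ∫ x in ball x₀ r, ‖fderiv ℝ (w k t) x‖ ^ 2 with hΦ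
    set Ψ : ℝ → ℝ := fun t => ∫ x in ball x₀ r, ‖fderiv ℝ (W t) x‖ ^ 2 with hΨ
    have hinner : ∀ t ∈ Ioo (t₀ - r ^ 2) t₀, Tendsto (fun k => Φ k t) atTop (𝓝 (Ψ t)) := by
      intro t ht
      have ht' : t < 0 := ht.2.trans ht₀
      have hf : ∀ᶠ k in atTop, Continuous (fderiv ℝ (w k t)) ∧ ∀ x, ‖fderiv ℝ (w k t) x‖ ≤ K := by
        filter_upwards [hKw, hwin] with k hk hk'
        exact ⟨(hsmooth k t ⟨by linarith [ht.1], ht'⟩).continuous_fderiv (by simp), fun x => hk t ht x⟩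
      exact tendsto_setIntegral_ball_norm_sq_of_eventually_bound hf (hptG t ht') x₀ r
    -- continuity (hence measurability) of the inner integrals in time
    have hΦc : ∀ k, ContinuousOn (Φ k) (Ioo (A k) 0) := fun k =>
      continuousOn_setIntegral_ball_norm_sq_of_continuousOn (g := fun t x => fderiv ℝ (w k t) x)
        isOpen_Ioo (hDc k) x₀ r
    -- dominated convergence in time
    set Vc : ℝ := ∫ x in ball x₀ r, (K ^ 2 : ℝ) with hVc
    have hΦbd : ∀ᶠ k in atTop, ∀ t ∈ Ioo (t₀ - r ^ 2) t₀, ‖Φ k t‖ ≤ Vc := by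
      filter_upwards [hKw, hwin] with k hk hk'
      intro t ht
      have htk : t ∈ Ioo (A k) 0 := ⟨by linarith [ht.1], ht.2.trans ht₀⟩
      have h0 : 0 ≤ Φ k t := setIntegral_nonneg measurableSet_ball fun x _ => sq_nonneg _
      rw [Real.norm_eq_abs, abs_of_nonneg h0]
      have hgi : IntegrableOn (fun x => ‖fderiv ℝ (w k t) x‖ ^ 2) (ball x₀ r) volume :=
        ((((hsmooth k t htk).continuous_fderiv (by simp)).norm.pow 2).continuousOn
          |>.integrableOn_compact (isCompact_closedBall x₀ r)) |>.mono_set ball_subset_closedBall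
      exact setIntegral_mono_on hgi (integrableOn_const (measure_ball_lt_top).ne)
        measurableSet_ball fun x _ => pow_le_pow_left₀ (norm_nonneg _) (hk t ht x) 2
    have hlimT : Tendsto (fun k => ∫ t in Ioo (t₀ - r ^ 2) t₀, Φ k t) atTop
        (𝓝 (∫ t in Ioo (t₀ - r ^ 2) t₀, Ψ t)) := by
      refine tendsto_integral_filter_of_dominated_convergence (fun _ => Vc) ?_ ?_ ?_ ?_
      · filter_upwards [hwin] with k hk
        exact ((hΦc k).mono fun t ht => ⟨by linarith [ht.1], ht.2.trans ht₀⟩).aestronglyMeasurable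
          measurableSet_Ioo
      · filter_upwards [hΦbd] with k hk
        exact (ae_restrict_mem measurableSet_Ioo).mono fun t ht => hk t ht
      · exact (integrableOn_const (measure_Ioo_lt_top).ne).integrable
      · exact (ae_restrict_mem measurableSet_Ioo).mono fun t ht => hinner t ht
    exact le_of_tendsto (hlimT.const_mul r⁻¹) (henE x₀ t₀ r ht₀ hr)
  -- assembly, with the vertex time `t₀ = 0` by exhaustion
  intro x₀ t₀ r ht₀ hr
  refine ⟨hAW x₀ t₀ r ht₀ hr, ?_⟩
  rcases lt_or_eq_of_le ht₀ with hlt | heq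
  · exact hEneg x₀ t₀ r hlt hr
  · subst heq
    have hΨc : ContinuousOn (fun t => ∫ x in ball x₀ r, ‖fderiv ℝ (W t) x‖ ^ 2) (Iio 0) :=
      continuousOn_setIntegral_ball_norm_sq_of_continuousOn (g := fun t x => fderiv ℝ (W t) x)
        isOpen_Iio hWDc x₀ r
    have h := scaledIntegral_vertex_zero hΨc
      (fun t _ => setIntegral_nonneg measurableSet_ball fun x _ => sq_nonneg _) hB hr
      (fun t₁ ht₁ => hEneg x₀ t₁ r ht₁ hr)
    rwa [zero_sub]

end Class

end Summit.NavierStokesRegularity.NavierStokesRegularity.Theorems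

end
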